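import Summits.BirchSwinnertonDyer.BirchSwinnertonDyer.Theorems.PrintX9JetchevX9Node
import Summits.BirchSwinnertonDyer.BirchSwinnertonDyer.Theorems.KatoDescentTamePotSupersingularJetchevIrreducibleReadingDivisibilityCoreVertexBridge
import HarnessLib

/-!
# Route `PrintX9`, crux J = `HeegnerDivisibilityX9` (item 20392), stub `stub_jetchevX9`: the BRIDGE — `stub_jetchevX9`
# (Jetchev 2008 Thm. 1.4 `m_∞ ≥ ord_p c_q`, one carrier at a time, on every X9 Heegner frame of large discriminant) from
# the X9 node `H63X9` (PROVED modulo three named Literature facts, `PrintX9JetchevX9Node`), the X9 READINGS of McCallum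
# 1991 Prop. 5.2 (`Prop52X9`, Kolyvagin's redefinition of `m_∞` — NOT print at non-surjective image) and of Jetchev Prop. 5.3
# (`CoreVertexExistenceX9`, the Prop. 6.4 walk — kernel port in progress), and bsd-jet's abstract §6

Cell `bsd-print-x9` (print tier, key `x9`), prover seat p4; `--supports stmt-BirchSwinnertonDyer-20392`,
helper; THEOREMS ONLY, nothing booked, no item closed, BSD is not proved by any of this.

WHAT. The X9 twin of bsd-potss k9-c4 g8's image-free road-K bridge
`JetchevIrreducibleReadingDivisibilityPrimed.divisibilityIrredAddv_of_prop52IrredP_of_coreVertexExistenceIrredP_of_thm63`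
(`derivedPoint_divisible_of_prop52Row_of_section6_min` over bsd-jet's `JET.Section6.depth_le_mdiv_of_coreVertices`):
§1 `exists_coreVertex_of_coreVertexExistenceX9` — `h64` (a core vertex of every level above a conductor attaining `m_∞`)
from the X9 reading `hCVX9` of Jetchev Prop. 5.3, the no-`p`-torsion step `E(K[c])[p] = 0` from irreducibility + `p` split
(x11b3's `NoTorsionIrr.torsionBy_ringClassField_eq_bot_of_hasIrreducibleModPGaloisRep`); §2 `prop52Row_of_prop52X9` — the
row shape `h52row` (for every bound `m′` a conductor of level `≥ m′` at exact depth `M_r`) from the X9 reading `h52X9` of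
McCallum Prop. 5.2; §3 `jetchevX9_of_readings_of_namedFacts` — the registered stub `stub_jetchevX9` of crux 20392 VERBATIM as
conclusion (bound `B := 4`, which excludes `d_K ∈ {−3, −4}`), from `h52X9`, `hCVX9` and the node (`JET.Split.h63X9_of_namedFacts h37 hPT hF1`), i.e.
**`stub_jetchevX9 ⟸ Prop52X9 ∧ CoreVertexExistenceX9 ∧ {Gross 1991 Prop. 3.7 (2), Poitou–Tate for Selmer structures,
[GZ86 III (3.1)] image-free}`**. The two readings are the X9 twins (binders `ClassX9 W p`, `SatisfiesHeegnerHypothesis p K`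
in place of `p ≠ 2`, `Irr`, `p ∣ N_E`) of crux 20165's registered stubs `stub_prop52IrredP` / `stub_coreVertexExistenceIrredP`
— READINGS (Jetchev Rem. 6.2: the printed proofs use the image only through the Čebotarev Cor. 3.2, UNCONDITIONAL on X9
frames by ty2's file H), displayed, nothing asserted. CONDITIONAL on the displayed hypotheses; the stub itself stays open.

References: [cite: Jetchev2008, Thm. 1.4 (p. 812), Prop. 5.3 (p. 823), Thm. 5.2 (p. 821), Rem. 6.2, proof of Thm. 1.1 (p. 824)]
[cite: McCallumLMS1991, §3 Cor. 3.2, §5 Prop. 5.2 (p. 304)] [cite: GrossLMS1991, §4 Lemma 4.3, Prop. 3.7 (2), §6]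
[cite: GrossZagier1986Heegner, III (3.1)].
-/

set_option autoImplicit false

noncomputable section

open scoped Classical

namespace Summit.BirchSwinnertonDyer.Rank1Residual.JET.Split

open WeierstrassCurve Literature.NumberTheory.EllipticCurves
  Literature.NumberTheory.EllipticCurves.ModularForms
  Literature.NumberTheory.EllipticCurves.Rank1Residual
  Literature.NumberTheory.GaloisCohomology
  Summit.BirchSwinnertonDyer.Rank1Residual Summit.BirchSwinnertonDyer.Rank1Residual.JET
  Summit.BirchSwinnertonDyer.BirchSwinnertonDyer.Theorems
  Summit.BirchSwinnertonDyer.BirchSwinnertonDyer.Theorems.JetchevIrreducibleReadingDivisibility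

/-! ### §1 Core vertices of every level from the X9 reading of Jetchev Prop. 5.3 -/

/-- **`h64` on an X9 Heegner frame from the X9 READING `hCVX9` of Jetchev 2008 Prop. 5.3** (= arXiv Prop. 6.4: a core
vertex of every level `m > s` above a conductor with non-torsion, exactly-`p^s`-divisible derived point and `s + m ≤ M(c)`;
bsd-jet's reading binder `JET.JetchevCoreVertexExistence` in the `s < m` form of `JET.jetchevCoreVertexExistence_lt_of_namedPrint`
/ potss' `stub_coreVertexExistenceIrredP`, with the row binders `ClassX9 W p`, `p` split in `K`). Proof byte-identical to potss' `exists_coreVertex_of_coreVertexExistenceIrredP`, the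
no-`p`-torsion step fed by irreducibility + `p` split (unramified). CONDITIONAL on `hCVX9`; nothing asserted.
[cite: Jetchev2008, Prop. 5.3 (p. 823), Lemma 5.1 and Rem. 6.2] [cite: GrossLMS1991, §4, Lemma 4.3] -/
theorem exists_coreVertex_of_coreVertexExistenceX9
    (hCVX9 : ∀ (W : WeierstrassCurve ℚ) [W.IsElliptic] [W.IsGloballyMinimal] [NeZero (W.conductorNorm ℤ)],
        ∀ (K : Type) [Field K] [NumberField K], IsImaginaryQuadratic K →
        NumberField.discr K ≠ -3 → NumberField.discr K ≠ -4 →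
        SatisfiesHeegnerHypothesis (W.conductorNorm ℤ) K →
        ∀ (τ : K ≃ₐ[ℚ] K), τ ≠ 1 →
        ∀ (p : ℕ) [Fact p.Prime], ClassX9 W p → SatisfiesHeegnerHypothesis p K →
        ∀ (Dt : ModularParametrizationData W (W.conductorNorm ℤ)) (β : ℤ) (ι : K →+* ℂ)
          [∀ k : ℕ, NumberField (ringClassField K ι k)]
          (d₁ : KolyvaginHeegnerData Dt β ι 1), ¬ IsOfFinAddOrder d₁.derivedPoint →
        ∀ (m : ℕ), 1 ≤ m →
        ∀ (c : ℕ) (d : KolyvaginHeegnerData Dt β ι c), Squarefree c →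
          (∀ ℓ ∈ c.primeFactors, Zhang2014.IsKolyvaginPrime (W.conductorNorm ℤ) W K p ℓ) →
        ∀ (s : ℕ), s < m → ¬ IsOfFinAddOrder d.derivedPoint →
          (∃ Q : (W.baseChange (ringClassField K ι c)).toAffine.Point,
            ((p ^ s : ℕ) : ℤ) • Q = d.derivedPoint) →
          (¬ ∃ Q : (W.baseChange (ringClassField K ι c)).toAffine.Point,
            ((p ^ (s + 1) : ℕ) : ℤ) • Q = d.derivedPoint) →
          ((s + m : ℕ) : ℕ∞) ≤ Zhang2014.levelIndex W p c →
          ∃ (c' : ℕ) (d' : KolyvaginHeegnerData Dt β ι c'), Squarefree c' ∧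
            (∀ ℓ ∈ c'.primeFactors, Zhang2014.IsKolyvaginPrime (W.conductorNorm ℤ) W K p ℓ ∧
              m + s ≤ Zhang2014.kolyvaginIndex W p ℓ) ∧
            Jetchev2008.IsGlobalCoreVertex W K ι τ p m c' ∧
            ¬ IsOfFinAddOrder d'.derivedPoint ∧
            ¬ ∃ Q : (W.baseChange (ringClassField K ι c')).toAffine.Point,
              ((p ^ (s + 1) : ℕ) : ℤ) • Q = d'.derivedPoint)
    (W : WeierstrassCurve ℚ) [W.IsElliptic] [W.IsGloballyMinimal] [NeZero (W.conductorNorm ℤ)]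
    (K : Type) [Field K] [NumberField K] (hK : IsImaginaryQuadratic K)
    (hD3 : NumberField.discr K ≠ -3) (hD4 : NumberField.discr K ≠ -4)
    (hH : SatisfiesHeegnerHypothesis (W.conductorNorm ℤ) K)
    (τ : K ≃ₐ[ℚ] K) (hτ : τ ≠ 1)
    (p : ℕ) [Fact p.Prime] (hX9 : ClassX9 W p) (hHp : SatisfiesHeegnerHypothesis p K)
    (Dt : ModularParametrizationData W (W.conductorNorm ℤ)) (β : ℤ) (ι : K →+* ℂ)
    [∀ k : ℕ, NumberField (ringClassField K ι k)]
    (d₁ : KolyvaginHeegnerData Dt β ι 1) (hy : ¬ IsOfFinAddOrder d₁.derivedPoint)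
    (mdiv m : {c : ℕ // Squarefree c ∧ ∀ ℓ ∈ c.primeFactors,
      Zhang2014.IsKolyvaginPrime (W.conductorNorm ℤ) W K p ℓ} → ℕ∞)
    (hchar : ∀ c (u : ℕ), (u : ℕ∞) ≤ mdiv c ↔ ∀ d : KolyvaginHeegnerData Dt β ι c.1,
      ∃ Q : (W.baseChange (ringClassField K ι c.1)).toAffine.Point,
        ((p ^ u : ℕ) : ℤ) • Q = d.derivedPoint)
    (hmdef : ∀ c, m c = if mdiv c < Zhang2014.levelIndex W p c.1 then mdiv c else ⊤)
    (mInf k : ℕ) (c : {c : ℕ // Squarefree c ∧ ∀ ℓ ∈ c.primeFactors,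
      Zhang2014.IsKolyvaginPrime (W.conductorNorm ℤ) W K p ℓ})
    (hk : 1 ≤ k) (hmc : m c = mInf) (hMc : (mInf : ℕ∞) + k ≤ Zhang2014.levelIndex W p c.1)
    (hik : mInf < k) :
    ∃ c' : {c : ℕ // Squarefree c ∧ ∀ ℓ ∈ c.primeFactors,
        Zhang2014.IsKolyvaginPrime (W.conductorNorm ℤ) W K p ℓ},
      Jetchev2008.IsGlobalCoreVertex W K ι τ p k c'.1 ∧
      (k : ℕ∞) + mInf ≤ Zhang2014.levelIndex W p c'.1 ∧ m c' ≤ mInf := by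
  have hp : p.Prime := Fact.out
  -- `mdiv c = mInf < M(c)`
  have hlt : mdiv c < Zhang2014.levelIndex W p c.1 := by
    by_contra h
    rw [hmdef, if_neg h] at hmc
    exact ENat.top_ne_coe mInf hmc
  have hmdiv : mdiv c = mInf := by rw [hmdef, if_pos hlt] at hmc; exact hmc
  -- a datum of exact depth `mInf`
  have hDv : ∀ d : KolyvaginHeegnerData Dt β ι c.1,
      ∃ Q : (W.baseChange (ringClassField K ι c.1)).toAffine.Point,
        ((p ^ mInf : ℕ) : ℤ) • Q = d.derivedPoint := (hchar c mInf).mp hmdiv.symm.le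
  have hnotDv : ¬ ∀ d : KolyvaginHeegnerData Dt β ι c.1,
      ∃ Q : (W.baseChange (ringClassField K ι c.1)).toAffine.Point,
        ((p ^ (mInf + 1) : ℕ) : ℤ) • Q = d.derivedPoint := by
    intro h
    have := (hchar c (mInf + 1)).mpr h
    rw [hmdiv, ENat.coe_le_coe] at this
    omega
  obtain ⟨d', hnd'⟩ := not_forall.mp hnotDv
  have hdiv' := hDv d'
  -- the derived point of `d'` is not torsion: `E(K[c])[p] = 0` from IRREDUCIBILITY (x11b3)
  have hc0 : c.1 ≠ 0 := c.2.1.ne_zero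
  have hpc : ¬ p ∣ c.1 := fun h ↦
    (c.2.2 p (Nat.mem_primeFactors.mpr ⟨hp, h, hc0⟩)).2.2.2.1 rfl
  have hbot := X11b.NoTorsionIrr.torsionBy_ringClassField_eq_bot_of_hasIrreducibleModPGaloisRep W hK ι hc0 hp
    hX9.ne_two hX9.irr (WeierstrassCurve.exists_weilPairing_holds W p)
    (X11b.isUnramifiedIn_of_satisfiesHeegnerHypothesis_of_dvd hK hHp hp (dvd_refl p)) hpc
  have hA : ∀ R : (W.baseChange (ringClassField K ι c.1)).toAffine.Point, (p : ℤ) • R = 0 → R = 0 := by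
    intro R hR
    have hmem : R ∈ AddSubgroup.torsionBy (W.baseChange (ringClassField K ι c.1)).toAffine.Point (p : ℤ) := by
      rw [mem_torsionBy_iff]
      exact hR
    rw [hbot] at hmem
    exact hmem
  have hnt : ¬ IsOfFinAddOrder d'.derivedPoint :=
    fun hfin ↦ hnd' (JET.exists_pow_smul_eq_of_isOfFinAddOrder hp hA hfin (mInf + 1))
  -- `c ∈ Λ_{mInf + k}`
  have hsM : ((mInf + k : ℕ) : ℕ∞) ≤ Zhang2014.levelIndex W p c.1 := by push_cast; exact hMc
  -- the X9 reading of Prop. 5.3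
  obtain ⟨c', d'', hsq', hℓ', hcore, -, hnd''⟩ := hCVX9 W K hK hD3 hD4 hH τ hτ p hX9 hHp Dt β ι d₁ hy k hk c.1 d'
    c.2.1 c.2.2 mInf hik hnt hdiv' hnd' hsM
  let cc : {c : ℕ // Squarefree c ∧ ∀ ℓ ∈ c.primeFactors,
      Zhang2014.IsKolyvaginPrime (W.conductorNorm ℤ) W K p ℓ} := ⟨c', hsq', fun ℓ h ↦ (hℓ' ℓ h).1⟩
  have hM' : (k : ℕ∞) + mInf ≤ Zhang2014.levelIndex W p c' := by
    have := Zhang2014.natCast_le_levelIndex_iff.mpr fun ℓ h ↦ (hℓ' ℓ h).2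
    push_cast at this
    exact this
  refine ⟨cc, hcore, hM', ?_⟩
  -- `m(c') ≤ mInf`: the datum `d''` is not divisible to depth `mInf + 1`
  have hle : mdiv cc ≤ mInf := by
    have h1 : ¬ ((mInf + 1 : ℕ) : ℕ∞) ≤ mdiv cc := fun h ↦ hnd'' ((hchar cc (mInf + 1)).mp h d'')
    rw [not_le] at h1
    have h2 : mdiv cc < (mInf : ℕ∞) + 1 := by exact_mod_cast h1
    exact (ENat.lt_add_one_iff (ENat.coe_ne_top mInf)).mp h2
  have hlt' : mdiv cc < Zhang2014.levelIndex W p cc.1 := by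
    refine lt_of_le_of_lt hle (lt_of_lt_of_le ?_ hM')
    have h1 : (mInf : ℕ∞) < (mInf : ℕ∞) + 1 :=
      (ENat.lt_add_one_iff (ENat.coe_ne_top mInf)).mpr le_rfl
    calc (mInf : ℕ∞) < (mInf : ℕ∞) + 1 := h1
      _ ≤ (k : ℕ∞) + mInf := by
        rw [add_comm]
        exact add_le_add_left (by exact_mod_cast hk) _
  rw [hmdef, if_pos hlt']
  exact hle

/-! ### §2 `h52row` from the X9 reading of McCallum Prop. 5.2 -/

/-- **`h52row` on an X9 Heegner frame from the X9 READING `h52X9` of McCallum 1991 Prop. 5.2** (Kolyvagin's redefinition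
of `m_∞`: `M_r < M ⟹ ∃ n ∈ Λ^r_M` with `ord c_M(n) = p^{M−M_r}` and `p^{M_r} ∥ P_n`; the tree's Literature fact
`McCallum1991.prop52_exists_conductor_kolyvaginClass_order_eq` carries the surjective tower, so at X9 image this is a READING
— no printed source; bsd-jet's kernel strike of Prop. 5.2 via the prime swap is in progress). Proof = potss'
`prop52Row_of_prop52IrredP` (Prop. 5.2 at `M := max m' (M_r + 1)`). CONDITIONAL on `h52X9`; nothing asserted.
[cite: McCallumLMS1991, §5 Prop. 5.2 (p. 304)] [cite: Jetchev2008, Rem. 6.2] -/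
theorem prop52Row_of_prop52X9
    (h52X9 : ∀ (W : WeierstrassCurve ℚ) [W.IsElliptic] [W.IsGloballyMinimal] [NeZero (W.conductorNorm ℤ)],
        ∀ (K : Type) [Field K] [NumberField K], IsImaginaryQuadratic K →
        NumberField.discr K ≠ -3 → NumberField.discr K ≠ -4 →
        SatisfiesHeegnerHypothesis (W.conductorNorm ℤ) K →
        ∀ (p : ℕ) [Fact p.Prime], ClassX9 W p → SatisfiesHeegnerHypothesis p K →
        ∀ (Dt : ModularParametrizationData W (W.conductorNorm ℤ)) (β : ℤ) (ι : K →+* ℂ)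
          (d₁ : KolyvaginHeegnerData Dt β ι 1), ¬ IsOfFinAddOrder d₁.derivedPoint →
        ∀ (r : ℕ), 0 < r →
        ∀ (Mr : ℕ),
          IsLeast {u : ℕ | ∃ (n : ℕ) (d : KolyvaginHeegnerData Dt β ι n), Squarefree n ∧
              n.primeFactors.card = r ∧
              (∀ ℓ ∈ n.primeFactors, Zhang2014.IsKolyvaginPrime (W.conductorNorm ℤ) W K p ℓ ∧
                u + 1 ≤ Zhang2014.kolyvaginIndex W p ℓ) ∧
              (∃ Q : (W.baseChange (ringClassField K ι n)).toAffine.Point,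
                ((p ^ u : ℕ) : ℤ) • Q = d.derivedPoint) ∧
              ¬ ∃ Q : (W.baseChange (ringClassField K ι n)).toAffine.Point,
                ((p ^ (u + 1) : ℕ) : ℤ) • Q = d.derivedPoint} Mr →
        ∀ (M : ℕ), Mr < M →
          ∃ (n : ℕ) (d : KolyvaginHeegnerData Dt β ι n), Squarefree n ∧ n.primeFactors.card = r ∧
            (∀ ℓ ∈ n.primeFactors, Zhang2014.IsKolyvaginPrime (W.conductorNorm ℤ) W K p ℓ ∧
              M ≤ Zhang2014.kolyvaginIndex W p ℓ) ∧
            addOrderOf (d.kolyvaginClass (Fact.out : p.Prime) M) = p ^ (M - Mr) ∧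
            (∃ Q : (W.baseChange (ringClassField K ι n)).toAffine.Point,
              ((p ^ Mr : ℕ) : ℤ) • Q = d.derivedPoint) ∧
            ¬ ∃ Q : (W.baseChange (ringClassField K ι n)).toAffine.Point,
              ((p ^ (Mr + 1) : ℕ) : ℤ) • Q = d.derivedPoint)
    (W : WeierstrassCurve ℚ) [W.IsElliptic] [W.IsGloballyMinimal] [NeZero (W.conductorNorm ℤ)]
    (K : Type) [Field K] [NumberField K] (hK : IsImaginaryQuadratic K)
    (hD3 : NumberField.discr K ≠ -3) (hD4 : NumberField.discr K ≠ -4)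
    (hH : SatisfiesHeegnerHypothesis (W.conductorNorm ℤ) K)
    (p : ℕ) [Fact p.Prime] (hX9 : ClassX9 W p) (hHp : SatisfiesHeegnerHypothesis p K)
    (Dt : ModularParametrizationData W (W.conductorNorm ℤ)) (β : ℤ) (ι : K →+* ℂ)
    (d₁ : KolyvaginHeegnerData Dt β ι 1) (hy : ¬ IsOfFinAddOrder d₁.derivedPoint)
    (r : ℕ) (hr : 0 < r) (Mr : ℕ)
    (hMr : IsLeast {u : ℕ | ∃ (n : ℕ) (d : KolyvaginHeegnerData Dt β ι n), Squarefree n ∧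
        n.primeFactors.card = r ∧
        (∀ ℓ ∈ n.primeFactors, Zhang2014.IsKolyvaginPrime (W.conductorNorm ℤ) W K p ℓ ∧
          u + 1 ≤ Zhang2014.kolyvaginIndex W p ℓ) ∧
        (∃ Q : (W.baseChange (ringClassField K ι n)).toAffine.Point,
          ((p ^ u : ℕ) : ℤ) • Q = d.derivedPoint) ∧
        ¬ ∃ Q : (W.baseChange (ringClassField K ι n)).toAffine.Point,
          ((p ^ (u + 1) : ℕ) : ℤ) • Q = d.derivedPoint} Mr)
    (m' : ℕ) :
    ∃ (n : ℕ) (d : KolyvaginHeegnerData Dt β ι n), Squarefree n ∧ n.primeFactors.card = r ∧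
      (∀ ℓ ∈ n.primeFactors, Zhang2014.IsKolyvaginPrime (W.conductorNorm ℤ) W K p ℓ) ∧
      (m' : ℕ∞) ≤ Zhang2014.levelIndex W p n ∧
      (∃ Q : (W.baseChange (ringClassField K ι n)).toAffine.Point,
        ((p ^ Mr : ℕ) : ℤ) • Q = d.derivedPoint) ∧
      ¬ ∃ Q : (W.baseChange (ringClassField K ι n)).toAffine.Point,
        ((p ^ (Mr + 1) : ℕ) : ℤ) • Q = d.derivedPoint := by
  obtain ⟨n, d, hsq, hcard, hℓ, -, hdiv, hndiv⟩ :=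
    h52X9 W K hK hD3 hD4 hH p hX9 hHp Dt β ι d₁ hy r hr Mr hMr
      (max m' (Mr + 1))
      (lt_of_lt_of_le (Nat.lt_succ_self Mr) (le_max_right _ _))
  refine ⟨n, d, hsq, hcard, fun ℓ hℓn ↦ (hℓ ℓ hℓn).1, ?_, hdiv, hndiv⟩
  rw [Zhang2014.natCast_le_levelIndex_iff]
  exact fun ℓ hℓn ↦ (le_max_left _ _).trans (hℓ ℓ hℓn).2

/-! ### §3 The registered stub `stub_jetchevX9` from the two X9 readings and three named Literature facts -/

/-- **`stub_jetchevX9` (crux 20392, registered signature VERBATIM as conclusion) ⟸ `Prop52X9` ∧ `CoreVertexExistenceX9` ∧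
{Gross 1991 Prop. 3.7 (2), Poitou–Tate for Selmer structures, [GZ86 III (3.1)] image-free}.** For every X9 pair of analytic rank `≤ 1` take `B := 4`; for a Heegner field `K` with `|d_K| > 4` (so
`d_K ∉ {−3, −4}`) and `p` split, a frame `(Dt, β, ι)` with non-torsion `y_K`, a carrier `q ∣ N_E` and `s ≤ ord_p c_q`:
every derived Heegner point of square-free conductor with Kolyvagin prime factors of index `≥ s` is `p^s`-divisible —
by bsd-jet's abstract §6 (`derivedPoint_divisible_of_prop52Row_of_section6_min`, with `Core k c := m_∞ < k → IsGlobalCoreVertex`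
as in `Rank1ResidualJetCoreVertexBridgeNoCV`) fed with §2 (`hK`), §1 (`h64`, asked only at levels `k > m_∞`) and the
node `JET.Split.h63X9_of_namedFacts h37 hPT hF1` (`h63`). X9 twin of potss' `divisibilityIrredAddv_of_prop52IrredP_of_coreVertexExistenceIrredP_of_thm63`; the
frame binders `4N ∣ β² − d_K`, `p ∤ c(Dt)` and `r_an ≤ 1` of the stub are not used. CONDITIONAL on the two readings and the
three named facts; nothing asserted; beyond print: the node (Jetchev Thm. 5.2 at non-surjective irreducible image) is a kernel theorem. [cite: Jetchev2008, Thm. 1.4 (p. 812), proof of Thm. 1.1 (p. 824), Rem. 6.2]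
[cite: McCallumLMS1991, §5 Prop. 5.2 (p. 304)] -/
theorem jetchevX9_of_readings_of_namedFacts
    (h52X9 : ∀ (W : WeierstrassCurve ℚ) [W.IsElliptic] [W.IsGloballyMinimal] [NeZero (W.conductorNorm ℤ)],
        ∀ (K : Type) [Field K] [NumberField K], IsImaginaryQuadratic K →
        NumberField.discr K ≠ -3 → NumberField.discr K ≠ -4 →
        SatisfiesHeegnerHypothesis (W.conductorNorm ℤ) K →
        ∀ (p : ℕ) [Fact p.Prime], ClassX9 W p → SatisfiesHeegnerHypothesis p K →
        ∀ (Dt : ModularParametrizationData W (W.conductorNorm ℤ)) (β : ℤ) (ι : K →+* ℂ)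
          (d₁ : KolyvaginHeegnerData Dt β ι 1), ¬ IsOfFinAddOrder d₁.derivedPoint →
        ∀ (r : ℕ), 0 < r →
        ∀ (Mr : ℕ),
          IsLeast {u : ℕ | ∃ (n : ℕ) (d : KolyvaginHeegnerData Dt β ι n), Squarefree n ∧
              n.primeFactors.card = r ∧
              (∀ ℓ ∈ n.primeFactors, Zhang2014.IsKolyvaginPrime (W.conductorNorm ℤ) W K p ℓ ∧
                u + 1 ≤ Zhang2014.kolyvaginIndex W p ℓ) ∧
              (∃ Q : (W.baseChange (ringClassField K ι n)).toAffine.Point,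
                ((p ^ u : ℕ) : ℤ) • Q = d.derivedPoint) ∧
              ¬ ∃ Q : (W.baseChange (ringClassField K ι n)).toAffine.Point,
                ((p ^ (u + 1) : ℕ) : ℤ) • Q = d.derivedPoint} Mr →
        ∀ (M : ℕ), Mr < M →
          ∃ (n : ℕ) (d : KolyvaginHeegnerData Dt β ι n), Squarefree n ∧ n.primeFactors.card = r ∧
            (∀ ℓ ∈ n.primeFactors, Zhang2014.IsKolyvaginPrime (W.conductorNorm ℤ) W K p ℓ ∧
              M ≤ Zhang2014.kolyvaginIndex W p ℓ) ∧
            addOrderOf (d.kolyvaginClass (Fact.out : p.Prime) M) = p ^ (M - Mr) ∧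
            (∃ Q : (W.baseChange (ringClassField K ι n)).toAffine.Point,
              ((p ^ Mr : ℕ) : ℤ) • Q = d.derivedPoint) ∧
            ¬ ∃ Q : (W.baseChange (ringClassField K ι n)).toAffine.Point,
              ((p ^ (Mr + 1) : ℕ) : ℤ) • Q = d.derivedPoint)
    (hCVX9 : ∀ (W : WeierstrassCurve ℚ) [W.IsElliptic] [W.IsGloballyMinimal] [NeZero (W.conductorNorm ℤ)],
        ∀ (K : Type) [Field K] [NumberField K], IsImaginaryQuadratic K →
        NumberField.discr K ≠ -3 → NumberField.discr K ≠ -4 →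
        SatisfiesHeegnerHypothesis (W.conductorNorm ℤ) K →
        ∀ (τ : K ≃ₐ[ℚ] K), τ ≠ 1 →
        ∀ (p : ℕ) [Fact p.Prime], ClassX9 W p → SatisfiesHeegnerHypothesis p K →
        ∀ (Dt : ModularParametrizationData W (W.conductorNorm ℤ)) (β : ℤ) (ι : K →+* ℂ)
          [∀ k : ℕ, NumberField (ringClassField K ι k)]
          (d₁ : KolyvaginHeegnerData Dt β ι 1), ¬ IsOfFinAddOrder d₁.derivedPoint →
        ∀ (m : ℕ), 1 ≤ m →
        ∀ (c : ℕ) (d : KolyvaginHeegnerData Dt β ι c), Squarefree c →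
          (∀ ℓ ∈ c.primeFactors, Zhang2014.IsKolyvaginPrime (W.conductorNorm ℤ) W K p ℓ) →
        ∀ (s : ℕ), s < m → ¬ IsOfFinAddOrder d.derivedPoint →
          (∃ Q : (W.baseChange (ringClassField K ι c)).toAffine.Point,
            ((p ^ s : ℕ) : ℤ) • Q = d.derivedPoint) →
          (¬ ∃ Q : (W.baseChange (ringClassField K ι c)).toAffine.Point,
            ((p ^ (s + 1) : ℕ) : ℤ) • Q = d.derivedPoint) →
          ((s + m : ℕ) : ℕ∞) ≤ Zhang2014.levelIndex W p c →
          ∃ (c' : ℕ) (d' : KolyvaginHeegnerData Dt β ι c'), Squarefree c' ∧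
            (∀ ℓ ∈ c'.primeFactors, Zhang2014.IsKolyvaginPrime (W.conductorNorm ℤ) W K p ℓ ∧
              m + s ≤ Zhang2014.kolyvaginIndex W p ℓ) ∧
            Jetchev2008.IsGlobalCoreVertex W K ι τ p m c' ∧
            ¬ IsOfFinAddOrder d'.derivedPoint ∧
            ¬ ∃ Q : (W.baseChange (ringClassField K ι c')).toAffine.Point,
              ((p ^ (s + 1) : ℕ) : ℤ) • Q = d'.derivedPoint)
    -- THREE NAMED LITERATURE FACTS (the inputs of the node `JET.Split.h63X9_of_namedFacts`)
    (h37 : GrossLMS1991.prop37_2_frobeniusCongruence)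
    (hPT : ∀ (K : Type) [Field K] [NumberField K], poitouTate_selmerStructure_duality_conj K)
    (hF1 : Gross1991_heegnerPoint_sub_ratTorsion_mem_E0_imageFree)
    :
    ∀ (W : WeierstrassCurve ℚ) [W.IsElliptic] [W.IsGloballyMinimal] [NeZero (W.conductorNorm ℤ)] (p : ℕ)
      [Fact p.Prime], Literature.NumberTheory.EllipticCurves.Rank1Residual.ClassX9 W p → W.analyticRank ≤ 1 →
      ∃ B : ℕ, ∀ (K : Type) [Field K] [NumberField K]
        (Dt : Literature.NumberTheory.EllipticCurves.ModularForms.ModularParametrizationData W (W.conductorNorm ℤ))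
        (β : ℤ) (ι : K →+* ℂ), Literature.NumberTheory.EllipticCurves.IsImaginaryQuadratic K →
        B < (NumberField.discr K).natAbs →
        Literature.NumberTheory.EllipticCurves.SatisfiesHeegnerHypothesis (W.conductorNorm ℤ) K →
        Literature.NumberTheory.EllipticCurves.SatisfiesHeegnerHypothesis p K →
        (4 * (W.conductorNorm ℤ : ℤ)) ∣ β ^ 2 - NumberField.discr K → ¬ (p : ℤ) ∣ Dt.c →
        ∀ (d₁ : Literature.NumberTheory.EllipticCurves.KolyvaginHeegnerData Dt β ι 1),
          ¬ IsOfFinAddOrder d₁.derivedPoint →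
        ∀ (q : ℕ) [Fact q.Prime], q ∣ W.conductorNorm ℤ →
        ∀ (s : ℕ), s ≤ padicValNat p ((W.baseChange ℚ_[q]).localTamagawaNumber ℤ_[q]) →
        ∀ (n : ℕ) (d : Literature.NumberTheory.EllipticCurves.KolyvaginHeegnerData Dt β ι n), Squarefree n →
          (∀ ℓ ∈ n.primeFactors,
            Literature.NumberTheory.EllipticCurves.Zhang2014.IsKolyvaginPrime (W.conductorNorm ℤ) W K p ℓ ∧
              s ≤ Literature.NumberTheory.EllipticCurves.Zhang2014.kolyvaginIndex W p ℓ) →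
          ∃ Q : (W.baseChange (Literature.NumberTheory.EllipticCurves.ringClassField K ι n)).toAffine.Point,
            ((p ^ s : ℕ) : ℤ) • Q = d.derivedPoint := by
  intro W _ _ _ p _ hX9 _
  refine ⟨4, ?_⟩
  intro K _ _ Dt β ι hK hBK hH hHp _ _ d₁ hy q _ hqN s hs n d hn hℓ
  have hp : p.Prime := Fact.out
  -- `|d_K| > 4` and `d_K < 0`: the two unit-rich fields are excluded
  have hneg : NumberField.discr K < 0 := IsImaginaryQuadratic.discr_neg hK
  have hlt : NumberField.discr K < -4 := by omega
  have hD3 : NumberField.discr K ≠ -3 := by omega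
  have hD4 : NumberField.discr K ≠ -4 := by omega
  obtain ⟨τ, hτ⟩ := exists_algEquiv_ne_one_of_isImaginaryQuadratic K hK
  haveI : ∀ k : ℕ, NumberField (ringClassField K ι k) := fun k ↦ numberField_ringClassField K hK ι k
  refine derivedPoint_divisible_of_prop52Row_of_section6_min W K p Dt β ι
    (prop52Row_of_prop52X9 h52X9 W K hK hD3 hD4 hH p hX9 hHp Dt β ι d₁ hy) _ ?_ s hs n d hn hℓ
  intro mdiv m hchar hmdef mInf hmInf hKoly
  refine ⟨fun k c ↦ mInf < k → Jetchev2008.IsGlobalCoreVertex W K ι τ p k c.1, ?_, ?_⟩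
  · intro k c hk hmc hMc
    by_cases hik : mInf < k
    · obtain ⟨c', hcore, hM', hm'⟩ := exists_coreVertex_of_coreVertexExistenceX9 hCVX9 W K hK hD3 hD4 hH τ hτ p hX9
        hHp Dt β ι d₁ hy mdiv m hchar hmdef mInf k c hk hmc hMc hik
      exact ⟨c', fun _ ↦ hcore, hM', hm'⟩
    · exact ⟨c, fun h ↦ absurd h hik, by rw [add_comm]; exact hMc, le_of_eq hmc⟩
  · intro k c hk hcore hmc hMc htk hik
    exact h63X9_of_namedFacts h37 hPT hF1 W K hK hD3 hD4 hH τ hτ p hX9 hHp Dt β ι d₁ hy q hqN mdiv m hchar hmdef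
      mInf hmInf hKoly k c hk (hcore hik) hmc hMc htk hik

end Summit.BirchSwinnertonDyer.Rank1Residual.JET.Split

end
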